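import Literature.Analysis.FluidPDE.ElgindiThetaDerivativeCoercivity
import Literature.Analysis.FluidPDE.ElgindiSinRpowIntegral
import HarnessLib

/-!
# The `η`-weighted `L²` coercivity of `𝓛_Γ^T` ([Elgindi2021] Proposition 6.7, vendored form)

Topic `Literature/Analysis/FluidPDE`. Proof file (everything proved, no definitions, no named
facts) on the proof path of the named fact
`Literature.Analysis.FluidPDE.Elgindi.ElgindiGhoulMasmoudi2021_stabilityCore`
(`ElgindiStabilityDecomposition.lean`). T. M. Elgindi, Ann. of Math. 194 (2021) =
arXiv:1904.04795 (`[Elgindi2021]`), §6.1 **Proposition 6.7** (p. 17 of the held text): "A similar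
calculation as above gives the following proposition. Let `η = 99/100`. Then,
`(𝓛_Γ^T(f)w, fw/sin(2θ)^η)_{L²} ≥ (1/5)|f w/√(sin(2θ)^η)|²_{L²} − 10⁵|z⁻¹L₁₂f|²_{L²}`."

## Vendored statement and why

We prove, for `0 < α ≤ 1/200` and `f ∈ C²` compactly supported inside the open strip with
`L₁₂(f)(0) = 0`:
`(1/5)∬_strip (fw)²sin(2θ)^{−η} − 10⁶∬_strip (fw)² ≤ ∬_strip 𝓛_Γ^T(f)·f·w²·sin(2θ)^{−η}`
(`Elgindi.etaWeightedCoercivity`). The printed right-hand error `10⁵|z⁻¹L₁₂f|²` is replaced by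
`10⁶|fw|²`; both are absorbed identically in the only use of Prop. 6.7, Corollary 6.8
(`10·(6.7) + 10⁸·(6.4) + 10¹²·(6.5)`), where `10⁸(𝓛_Γ^Tfw, fw) ≥ 2·10⁷|fw|² − …` dominates either
(and `|z⁻¹L₁₂f|² ≤ (9π/8)|fw|²` by Hardy, `integral_sq_L12_div_sq_le`). The "similar calculation":
with `ρ = sin(2θ)^{−η}`, `X² = ∬(fw)²ρ`, `A = ∬(fw)²`, the pairing splits (Def. 6.1/6.2) as
`E₁ − E₂ − E₃ + ℓ₀J` with `E₁ = ½X²` (`integral_strip_opL_energy_weight`),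
`E₂² ≤ X²(4/c²)(∫L₁₂(f)²/z²)(∫Γ²ρ) ≤ 4625AX²` (`∫Γ²sin^{−η} ≤ 100π`,
`ElgindiSinRpowIntegral.lean`), `|E₃| ≤ 3(1−η)X²` (transport by parts, `u = sin(2θ)^{1−η}`),
`ℓ₀² ≤ 153A` (`sq_L12_transport_le_sq_norm`), `J² ≤ 1309X²`; hence `≥ (½ − 0.1 − 0.03 − 0.1)X² −
(11563 + 500693)A ≥ (1/5)X² − 10⁶A`.
-/

noncomputable section

open MeasureTheory Set Function Real Filter
open _root_.Topology

namespace Literature.Analysis.FluidPDE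

namespace Elgindi

section Prop67

variable {α : ℝ} {f : ℝ → ℝ → ℝ} (hf : ContDiff ℝ 2 (uncurry f)) (hs : HasCompactSupport (uncurry f))
  (hsub : tsupport (uncurry f) ⊆ strip)

include hf hs hsub

/-- Integrability on the strip of `c·f·w²·sin(2θ)^{−η}` for `c` continuous on the strip. [folklore] -/
theorem integrableOn_mul_f_weight_eta {c : ℝ × ℝ → ℝ} (hc : ContinuousOn c strip) :
    IntegrableOn (fun p : ℝ × ℝ => c p * f p.1 p.2 * radialWeight p.1 ^ 2 *
      Real.sin (2 * p.2) ^ (-eta)) strip := by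
  have hf0 : ∀ p : ℝ × ℝ, p ∉ tsupport (uncurry f) → f p.1 p.2 = 0 := fun p hp =>
    (image_eq_zero_of_notMem_tsupport hp : uncurry f p = 0)
  have hwon : ContinuousOn (fun p : ℝ × ℝ => radialWeight p.1) strip := by
    unfold radialWeight
    exact ContinuousOn.div (by fun_prop) (by fun_prop) fun p hp => pow_ne_zero 2 (ne_of_gt hp.1)
  have hρon : ContinuousOn (fun p : ℝ × ℝ => Real.sin (2 * p.2) ^ (-eta)) strip :=
    ((contDiffOn_sin_two_mul_rpow (-eta)).continuousOn).comp continuousOn_snd fun p hp => hp.2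
  have hcont : Continuous fun p : ℝ × ℝ =>
      c p * f p.1 p.2 * radialWeight p.1 ^ 2 * Real.sin (2 * p.2) ^ (-eta) :=
    continuous_of_continuousOn_strip (isClosed_tsupport _) hsub
      (((hc.mul hf.continuous.continuousOn).mul (hwon.pow 2)).mul hρon) fun p hp => by simp [hf0 p hp]
  exact (hcont.integrable_of_hasCompactSupport (HasCompactSupport.intro hs fun p hp => by
    simp [hf0 p hp])).integrableOn

/-- **The transport term by parts, `η`-weight**: `∬(3/(1+z))D_θf·f·w²sin(2θ)^{−η} =
−(1−η)∬(3cos(2θ)/(1+z))f²w²sin(2θ)^{−η}` (`u = sin(2θ)^{1−η}`). [cite: Elgindi2021, §6.1 Proposition 6.7 ("A similar calculation as above") (p. 17 of arXiv:1904.04795)] -/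
theorem integral_transport_eta_byParts :
    ∫ p in strip, 3 / (1 + p.1) * Dθ f p.1 p.2 * f p.1 p.2 * radialWeight p.1 ^ 2 *
        Real.sin (2 * p.2) ^ (-eta) =
      -(1 - eta) * ∫ p in strip, 3 * Real.cos (2 * p.2) / (1 + p.1) * f p.1 p.2 ^ 2 *
        radialWeight p.1 ^ 2 * Real.sin (2 * p.2) ^ (-eta) := by
  have hfC : ContDiff ℝ 1 (uncurry f) := hf.of_le (by norm_num)
  set G : ℝ × ℝ → ℝ := fun p => 3 * radialWeight p.1 ^ 2 / (2 * (1 + p.1)) * f p.1 p.2 ^ 2 with hG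
  set u : ℝ → ℝ := fun θ => Real.sin (2 * θ) ^ (1 - eta) with hu
  have hw : ContDiffOn ℝ 1 (fun p : ℝ × ℝ => radialWeight p.1) strip := by
    unfold radialWeight
    exact ContDiffOn.div (by fun_prop) (by fun_prop) fun p hp => pow_ne_zero 2 (ne_of_gt hp.1)
  have hGon : ContDiffOn ℝ 1 G strip := by
    refine (ContDiffOn.div ((hw.pow 2).const_smul (3 : ℝ) |>.congr fun p _ => by
      simp [smul_eq_mul]) (by fun_prop) fun p hp => ?_).mul (hfC.contDiffOn.pow 2)
    have : (0 : ℝ) < p.1 := hp.1; positivity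
  have hG_sub : tsupport G ⊆ tsupport (uncurry f) := by
    have : G = fun p => uncurry f p * (3 * radialWeight p.1 ^ 2 / (2 * (1 + p.1)) * f p.1 p.2) := by
      funext p; simp only [hG, uncurry]; ring
    rw [this]
    exact tsupport_mul_subset_left
  have hGs : HasCompactSupport G := by
    have : G = fun p => uncurry f p * (3 * radialWeight p.1 ^ 2 / (2 * (1 + p.1)) * f p.1 p.2) := by
      funext p; simp only [hG, uncurry]; ring
    rw [this]
    exact hs.mul_right
  have huC : ContDiffOn ℝ 1 u (Ioo 0 (π / 2)) := contDiffOn_sin_two_mul_rpow _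
  have hbp := integral_strip_weight_mul_deriv_slice_snd hGon hGs (hG_sub.trans hsub) huC
  have hu' : ∀ θ ∈ Ioo 0 (π / 2), deriv u θ = (1 - eta) * (2 * Real.cos (2 * θ)) * Real.sin (2 * θ) ^ (-eta) := by
    intro θ hθ
    have hsθ : 0 < Real.sin (2 * θ) := Real.sin_pos_of_pos_of_lt_pi (by linarith [hθ.1]) (by linarith [hθ.2])
    have h1 : HasDerivAt (fun θ : ℝ => Real.sin (2 * θ)) (Real.cos (2 * θ) * 2) θ := by
      simpa using ((hasDerivAt_id θ).const_mul (2 : ℝ)).sin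
    have h2 := h1.rpow_const (p := 1 - eta) (Or.inl hsθ.ne')
    rw [show u = fun θ => Real.sin (2 * θ) ^ (1 - eta) from rfl, h2.deriv]
    rw [show (1 : ℝ) - eta - 1 = -eta by ring]
    ring
  have hGsl : ∀ p ∈ strip, deriv (fun θ => G (p.1, θ)) p.2 =
      3 * radialWeight p.1 ^ 2 / (2 * (1 + p.1)) * (2 * f p.1 p.2 * dθ f p.1 p.2) := by
    intro p hp
    have hgd : HasDerivAt (fun θ => f p.1 θ) (dθ f p.1 p.2) p.2 := by
      have hd : DifferentiableAt ℝ (uncurry f) p := (hfC.differentiable (by norm_num)) p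
      have h := hasDerivAt_slice_snd hd
      rw [dθ_eq_fderiv hd]
      exact h
    have := ((hgd.fun_pow 2).const_mul (3 * radialWeight p.1 ^ 2 / (2 * (1 + p.1)))).deriv
    simp only [hG]
    rw [this]
    ring
  have eL : ∫ p in strip, u p.2 * deriv (fun θ => G (p.1, θ)) p.2 =
      ∫ p in strip, 3 / (1 + p.1) * Dθ f p.1 p.2 * f p.1 p.2 * radialWeight p.1 ^ 2 *
        Real.sin (2 * p.2) ^ (-eta) := by
    refine setIntegral_congr_fun measurableSet_strip fun p hp => ?_
    have hsθ : 0 < Real.sin (2 * p.2) :=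
      Real.sin_pos_of_pos_of_lt_pi (by linarith [hp.2.1]) (by linarith [hp.2.2])
    rw [hGsl p hp]
    simp only [hu, Dθ_eq_mul_dθ]
    have e1 : Real.sin (2 * p.2) ^ (1 - eta) = Real.sin (2 * p.2) * Real.sin (2 * p.2) ^ (-eta) := by
      rw [show (1 : ℝ) - eta = 1 + -eta by ring, Real.rpow_add hsθ, Real.rpow_one]
    rw [e1]
    have hz1 : (1 : ℝ) + p.1 ≠ 0 := by have : (0 : ℝ) < p.1 := hp.1; positivity
    field_simp
  have eR : ∫ p in strip, deriv u p.2 * G p =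
      (1 - eta) * ∫ p in strip, 3 * Real.cos (2 * p.2) / (1 + p.1) * f p.1 p.2 ^ 2 *
        radialWeight p.1 ^ 2 * Real.sin (2 * p.2) ^ (-eta) := by
    rw [← integral_const_mul]
    refine setIntegral_congr_fun measurableSet_strip fun p hp => ?_
    rw [hu' p.2 hp.2]
    simp only [hG]
    have hz1 : (1 : ℝ) + p.1 ≠ 0 := by have : (0 : ℝ) < p.1 := hp.1; positivity
    field_simp
  rw [eL, eR] at hbp
  rw [hbp]
  ring

/-- The transport term is perturbative: `−∬(3/(1+z))D_θf·f·w²sin^{−η} ≥ −(3/100)∬(fw)²sin^{−η}`. [folklore] -/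
theorem integral_transport_eta_ge :
    -(3 / 100) * ∫ p in strip, (f p.1 p.2 * radialWeight p.1) ^ 2 * Real.sin (2 * p.2) ^ (-eta) ≤
      -∫ p in strip, 3 / (1 + p.1) * Dθ f p.1 p.2 * f p.1 p.2 * radialWeight p.1 ^ 2 *
        Real.sin (2 * p.2) ^ (-eta) := by
  rw [integral_transport_eta_byParts hf hs hsub]
  have i1 := integrableOn_mul_f_weight_eta hf hs hsub (c := fun p : ℝ × ℝ => f p.1 p.2)
    hf.continuous.continuousOn
  have i2 := integrableOn_mul_f_weight_eta hf hs hsub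
    (c := fun p : ℝ × ℝ => 3 * Real.cos (2 * p.2) / (1 + p.1) * f p.1 p.2)
    ((ContinuousOn.div (by fun_prop) (by fun_prop) fun p hp => by
      have : (0 : ℝ) < p.1 := hp.1; positivity).mul hf.continuous.continuousOn)
  have hX : ∫ p in strip, (f p.1 p.2 * radialWeight p.1) ^ 2 * Real.sin (2 * p.2) ^ (-eta) =
      ∫ p in strip, f p.1 p.2 * f p.1 p.2 * radialWeight p.1 ^ 2 * Real.sin (2 * p.2) ^ (-eta) :=
    setIntegral_congr_fun measurableSet_strip fun p _ => by ring
  have hI : ∫ p in strip, 3 * Real.cos (2 * p.2) / (1 + p.1) * f p.1 p.2 ^ 2 *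
      radialWeight p.1 ^ 2 * Real.sin (2 * p.2) ^ (-eta) =
      ∫ p in strip, 3 * Real.cos (2 * p.2) / (1 + p.1) * f p.1 p.2 * f p.1 p.2 *
        radialWeight p.1 ^ 2 * Real.sin (2 * p.2) ^ (-eta) :=
    setIntegral_congr_fun measurableSet_strip fun p _ => by ring
  have hbound : |∫ p in strip, 3 * Real.cos (2 * p.2) / (1 + p.1) * f p.1 p.2 * f p.1 p.2 *
      radialWeight p.1 ^ 2 * Real.sin (2 * p.2) ^ (-eta)| ≤
      3 * ∫ p in strip, (f p.1 p.2 * radialWeight p.1) ^ 2 * Real.sin (2 * p.2) ^ (-eta) := by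
    rw [hX, ← integral_const_mul]
    refine abs_integral_le_integral_abs.trans (setIntegral_mono_on i2.abs (i1.const_mul _)
      measurableSet_strip fun p hp => ?_)
    have hz : (0 : ℝ) < p.1 := hp.1
    have hsθ : 0 < Real.sin (2 * p.2) :=
      Real.sin_pos_of_pos_of_lt_pi (by linarith [hp.2.1]) (by linarith [hp.2.2])
    have hρ0 : 0 ≤ Real.sin (2 * p.2) ^ (-eta) := Real.rpow_nonneg hsθ.le _
    have hc : |3 * Real.cos (2 * p.2) / (1 + p.1)| ≤ 3 := by
      rw [abs_div, abs_of_pos (by positivity : (0 : ℝ) < 1 + p.1), div_le_iff₀ (by positivity), abs_mul,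
        abs_of_pos (by norm_num : (0 : ℝ) < 3)]
      nlinarith [Real.abs_cos_le_one (2 * p.2), abs_nonneg (Real.cos (2 * p.2))]
    have e : 3 * Real.cos (2 * p.2) / (1 + p.1) * f p.1 p.2 * f p.1 p.2 * radialWeight p.1 ^ 2 *
        Real.sin (2 * p.2) ^ (-eta) = (3 * Real.cos (2 * p.2) / (1 + p.1)) *
        (f p.1 p.2 ^ 2 * radialWeight p.1 ^ 2 * Real.sin (2 * p.2) ^ (-eta)) := by ring
    rw [e, abs_mul]
    have hnn : 0 ≤ f p.1 p.2 ^ 2 * radialWeight p.1 ^ 2 * Real.sin (2 * p.2) ^ (-eta) := by positivity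
    rw [abs_of_nonneg hnn]
    calc |3 * Real.cos (2 * p.2) / (1 + p.1)| * (f p.1 p.2 ^ 2 * radialWeight p.1 ^ 2 *
          Real.sin (2 * p.2) ^ (-eta)) ≤ 3 * (f p.1 p.2 ^ 2 * radialWeight p.1 ^ 2 *
          Real.sin (2 * p.2) ^ (-eta)) := mul_le_mul_of_nonneg_right hc hnn
      _ = 3 * (f p.1 p.2 * f p.1 p.2 * radialWeight p.1 ^ 2 * Real.sin (2 * p.2) ^ (-eta)) := by ring
  rw [hI]
  have h := (abs_le.1 hbound).1
  have h' := (abs_le.1 hbound).2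
  have heta : (1 : ℝ) - eta = 1 / 100 := by unfold eta; norm_num
  rw [heta]
  nlinarith [h, h']

/-- **The `Γ`-term against `L₁₂(f)`, `η`-weight**: with `E₂ = ∬(2zΓ/(c(1+z)²))L₁₂(f)·f·w²sin^{−η}`,
`E₂² ≤ 4625·∬(fw)²·∬(fw)²sin^{−η}` (`0 < α ≤ 1/200`, `L₁₂(f)(0) = 0`). [cite: Elgindi2021, §6.1 Proposition 6.7 (p. 17 of arXiv:1904.04795)] -/
theorem sq_E2_eta_le (hα : 0 < α) (hα' : α ≤ 1 / 200) (hL0 : L12 f 0 = 0) :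
    (∫ p in strip, 2 * p.1 * angularWeight α p.2 / (profileConst α * (1 + p.1) ^ 2) * L12 f p.1 *
        f p.1 p.2 * radialWeight p.1 ^ 2 * Real.sin (2 * p.2) ^ (-eta)) ^ 2 ≤
      4625 * (∫ p in strip, (f p.1 p.2 * radialWeight p.1) ^ 2) *
        ∫ p in strip, (f p.1 p.2 * radialWeight p.1) ^ 2 * Real.sin (2 * p.2) ^ (-eta) := by
  have hcpos : 0 < profileConst α := profileConst_pos hα.le
  have hc49 : (49 / 50 : ℝ) ≤ profileConst α := profileConst_ge hα.le hα'
  have hfc : Continuous (uncurry f) := hf.continuous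
  obtain ⟨a, b, ha, -, hfab⟩ := exists_radial_bounds' hs hsub
  set L : ℝ → ℝ := L12 f with hLdef
  have hLa : ∀ z, z < a → L z = 0 := fun z hz => (L12_eq_L12_zero_of_le hfc ha hfab hz.le).trans hL0
  have hLb : ∀ z, b < z → L z = 0 := fun z hz => L12_eq_zero_of_le hfc ha hfab hz.le
  have hLc : Continuous L := continuous_L12 hfc hs hsub
  have hΓc : Continuous (angularWeight α) := continuous_angularWeight hα.le
  set τ : ℝ → ℝ := fun θ => Real.sin (2 * θ) ^ (-eta / 2) with hτ
  set φ : ℝ × ℝ → ℝ := fun p => f p.1 p.2 * radialWeight p.1 * τ p.2 with hφ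
  set ψ : ℝ × ℝ → ℝ := fun p => 2 / (profileConst α * p.1) * L p.1 * angularWeight α p.2 * τ p.2 with hψ
  have hτ2 : ∀ p ∈ strip, τ p.2 ^ 2 = Real.sin (2 * p.2) ^ (-eta) := fun p hp =>
    rpow_half_sq (Real.sin_pos_of_pos_of_lt_pi (by linarith [hp.2.1]) (by linarith [hp.2.2]))
  have eφψ : ∀ p ∈ strip, φ p * ψ p = 2 * p.1 * angularWeight α p.2 / (profileConst α * (1 + p.1) ^ 2) *
      L12 f p.1 * f p.1 p.2 * radialWeight p.1 ^ 2 * Real.sin (2 * p.2) ^ (-eta) := by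
    intro p hp
    have hz : (0 : ℝ) < p.1 := hp.1
    rw [← hτ2 p hp]
    simp only [hφ, hψ, hLdef]
    unfold radialWeight
    field_simp
  have eφ2 : ∀ p ∈ strip, φ p ^ 2 = (f p.1 p.2 * radialWeight p.1) ^ 2 * Real.sin (2 * p.2) ^ (-eta) := by
    intro p hp
    rw [← hτ2 p hp]
    simp only [hφ]
    ring
  have eψ2 : ∀ p ∈ strip, ψ p ^ 2 = (4 / profileConst α ^ 2 * (1 / p.1 ^ 2 * L p.1 ^ 2)) *
      (angularWeight α p.2 ^ 2 * Real.sin (2 * p.2) ^ (-eta)) := by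
    intro p hp
    have hz : (0 : ℝ) < p.1 := hp.1
    rw [← hτ2 p hp]
    simp only [hψ]
    field_simp
    ring
  have iφψ : IntegrableOn (fun p => φ p * ψ p) strip := by
    have hc : ContinuousOn (fun p : ℝ × ℝ => 2 * p.1 * angularWeight α p.2 /
        (profileConst α * (1 + p.1) ^ 2) * L12 f p.1) strip := by
      refine (ContinuousOn.div (by exact ((continuous_const.mul continuous_fst).mul
        (hΓc.comp continuous_snd)).continuousOn) (by fun_prop) fun p hp => ?_).mul
        (hLc.comp continuous_fst).continuousOn
      have : (0 : ℝ) < p.1 := hp.1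
      exact mul_ne_zero hcpos.ne' (by positivity)
    exact (integrableOn_mul_f_weight_eta hf hs hsub hc).congr_fun (fun p hp => (eφψ p hp).symm) measurableSet_strip
  have iφ2 : IntegrableOn (fun p => φ p ^ 2) strip := by
    have h := integrableOn_mul_f_weight_eta hf hs hsub (c := fun p : ℝ × ℝ => f p.1 p.2)
      hfc.continuousOn
    refine h.congr_fun (fun p hp => ?_) measurableSet_strip
    rw [eφ2 p hp]; ring
  have iz : Integrable (fun z : ℝ => 4 / profileConst α ^ 2 * (1 / z ^ 2 * L z ^ 2)) (volume.restrict (Ioi 0)) := by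
    have hu2 : ContinuousOn (fun z : ℝ => 1 / z ^ 2) {0}ᶜ :=
      ContinuousOn.div continuousOn_const (continuousOn_id.pow 2) fun z hz => pow_ne_zero 2 hz
    have hLs : HasCompactSupport L := by
      refine HasCompactSupport.intro (isCompact_Icc (a := a) (b := b)) fun z hz => ?_
      rcases not_and_or.1 (fun h => hz ⟨h.1, h.2⟩ : ¬(a ≤ z ∧ z ≤ b)) with h | h
      · exact hLa z (not_le.1 h)
      · exact hLb z (not_le.1 h)
    have h : Integrable (fun z : ℝ => 1 / z ^ 2 * L z ^ 2) :=
      (continuous_mul_of_eq_zero_lt hu2 (hLc.pow 2) ha fun z hz => by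
        simp [hLa z hz]).integrable_of_hasCompactSupport
        (HasCompactSupport.intro hLs fun z hz => by simp [image_eq_zero_of_notMem_tsupport hz])
    exact (h.const_mul _).integrableOn
  have iθ : Integrable (fun θ : ℝ => angularWeight α θ ^ 2 * Real.sin (2 * θ) ^ (-eta))
      (volume.restrict (Ioo 0 (π / 2))) := integrableOn_angularWeight_sq_mul_rpow_eta hα.le
  have iψ2 : IntegrableOn (fun p => ψ p ^ 2) strip := by
    have h := iz.mul_prod iθ
    rw [← volume_restrict_strip] at h
    exact IntegrableOn.congr_fun h (fun p hp => (eψ2 p hp).symm) measurableSet_strip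
  have hCS := sq_integral_mul_le iφ2 iψ2 iφψ
  have hψ2 : ∫ p in strip, ψ p ^ 2 = (4 / profileConst α ^ 2 * ∫ z in Ioi 0, 1 / z ^ 2 * L z ^ 2) *
      ∫ θ in Ioo 0 (π / 2), angularWeight α θ ^ 2 * Real.sin (2 * θ) ^ (-eta) := by
    rw [setIntegral_congr_fun measurableSet_strip eψ2, volume_restrict_strip,
      integral_prod_mul (f := fun z : ℝ => 4 / profileConst α ^ 2 * (1 / z ^ 2 * L z ^ 2))
        (g := fun θ : ℝ => angularWeight α θ ^ 2 * Real.sin (2 * θ) ^ (-eta)), integral_const_mul]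
  have hLz : ∫ z in Ioi 0, 1 / z ^ 2 * L z ^ 2 = ∫ z, 1 / z ^ 2 * L z ^ 2 := by
    refine setIntegral_eq_integral_of_forall_compl_eq_zero fun z hz => ?_
    rw [hLa z (lt_of_le_of_lt (not_lt.1 hz) ha)]; ring
  have hHardy := integral_sq_L12_div_sq_le hf hs hsub hL0
  have hAng := integral_angularWeight_sq_mul_rpow_eta_le hα.le
  set A : ℝ := ∫ p in strip, (f p.1 p.2 * radialWeight p.1) ^ 2 with hA
  set X : ℝ := ∫ p in strip, (f p.1 p.2 * radialWeight p.1) ^ 2 * Real.sin (2 * p.2) ^ (-eta) with hX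
  have hA0 : 0 ≤ A := integral_nonneg fun p => sq_nonneg _
  have hX0 : 0 ≤ X := by
    simp only [hX]
    rw [← setIntegral_congr_fun measurableSet_strip eφ2]
    exact integral_nonneg fun p => sq_nonneg _
  have hLz0 : 0 ≤ ∫ z, 1 / z ^ 2 * L z ^ 2 := integral_nonneg fun z => by positivity
  have hAng0 : 0 ≤ ∫ θ in Ioo 0 (π / 2), angularWeight α θ ^ 2 * Real.sin (2 * θ) ^ (-eta) := by
    refine setIntegral_nonneg measurableSet_Ioo fun θ hθ => ?_
    have hsθ : 0 < Real.sin (2 * θ) := Real.sin_pos_of_pos_of_lt_pi (by linarith [hθ.1]) (by linarith [hθ.2])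
    exact mul_nonneg (sq_nonneg _) (Real.rpow_nonneg hsθ.le _)
  have eT : ∫ p in strip, 2 * p.1 * angularWeight α p.2 / (profileConst α * (1 + p.1) ^ 2) * L12 f p.1 *
      f p.1 p.2 * radialWeight p.1 ^ 2 * Real.sin (2 * p.2) ^ (-eta) = ∫ p in strip, φ p * ψ p :=
    (setIntegral_congr_fun measurableSet_strip eφψ).symm
  have eX : ∫ p in strip, φ p ^ 2 = X := setIntegral_congr_fun measurableSet_strip eφ2
  rw [eT]
  rw [eX, hψ2, hLz] at hCS
  have hc2 : 4 / profileConst α ^ 2 ≤ 4 / (49 / 50 : ℝ) ^ 2 := by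
    apply div_le_div_of_nonneg_left (by norm_num) (by norm_num)
    exact pow_le_pow_left₀ (by norm_num) hc49 2
  have hπ := Real.pi_lt_d4
  have hψ2le : (4 / profileConst α ^ 2 * ∫ z, 1 / z ^ 2 * L z ^ 2) *
      ∫ θ in Ioo 0 (π / 2), angularWeight α θ ^ 2 * Real.sin (2 * θ) ^ (-eta) ≤ 4625 * A := by
    have h1 : 4 / profileConst α ^ 2 * ∫ z, 1 / z ^ 2 * L z ^ 2 ≤ 4 / (49 / 50 : ℝ) ^ 2 * (9 * π / 8 * A) :=
      mul_le_mul hc2 hHardy hLz0 (by norm_num)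
    have hππA : π * (π * A) ≤ 3.1416 * (3.1416 * A) :=
      mul_le_mul hπ.le (mul_le_mul_of_nonneg_right hπ.le hA0) (by positivity) (by norm_num)
    calc (4 / profileConst α ^ 2 * ∫ z, 1 / z ^ 2 * L z ^ 2) *
          ∫ θ in Ioo 0 (π / 2), angularWeight α θ ^ 2 * Real.sin (2 * θ) ^ (-eta)
        ≤ (4 / (49 / 50 : ℝ) ^ 2 * (9 * π / 8 * A)) * (100 * π) := mul_le_mul h1 hAng hAng0 (by positivity)
      _ ≤ 4625 * A := by nlinarith [hππA, hA0]
  calc (∫ p in strip, φ p * ψ p) ^ 2 ≤ X * ((4 / profileConst α ^ 2 * ∫ z, 1 / z ^ 2 * L z ^ 2) *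
        ∫ θ in Ioo 0 (π / 2), angularWeight α θ ^ 2 * Real.sin (2 * θ) ^ (-eta)) := hCS
    _ ≤ X * (4625 * A) := mul_le_mul_of_nonneg_left hψ2le hX0
    _ = 4625 * A * X := by ring

/-- **The projector profile pairing, `η`-weight**: `J = ∬(Γ/c)(2z²/(1+z)³)·f·w²sin^{−η}` has
`J² ≤ 1309·∬(fw)²sin^{−η}` (`0 < α ≤ 1/200`). [cite: Elgindi2021, §6.1 Proposition 6.7 (p. 17 of arXiv:1904.04795)] -/
theorem sq_J_eta_le (hα : 0 < α) (hα' : α ≤ 1 / 200) :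
    (∫ p in strip, projKernel α p.1 p.2 * f p.1 p.2 * radialWeight p.1 ^ 2 * Real.sin (2 * p.2) ^ (-eta)) ^ 2 ≤
      1309 * ∫ p in strip, (f p.1 p.2 * radialWeight p.1) ^ 2 * Real.sin (2 * p.2) ^ (-eta) := by
  have hcpos : 0 < profileConst α := profileConst_pos hα.le
  have hc49 : (49 / 50 : ℝ) ≤ profileConst α := profileConst_ge hα.le hα'
  have hΓc : Continuous (angularWeight α) := continuous_angularWeight hα.le
  have hfc : Continuous (uncurry f) := hf.continuous
  set τ : ℝ → ℝ := fun θ => Real.sin (2 * θ) ^ (-eta / 2) with hτ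
  set φ : ℝ × ℝ → ℝ := fun p => f p.1 p.2 * radialWeight p.1 * τ p.2 with hφ
  set ψ : ℝ × ℝ → ℝ := fun p => 2 / (profileConst α * (1 + p.1)) * angularWeight α p.2 * τ p.2 with hψ
  have hτ2 : ∀ p ∈ strip, τ p.2 ^ 2 = Real.sin (2 * p.2) ^ (-eta) := fun p hp =>
    rpow_half_sq (Real.sin_pos_of_pos_of_lt_pi (by linarith [hp.2.1]) (by linarith [hp.2.2]))
  have eφψ : ∀ p ∈ strip, φ p * ψ p = projKernel α p.1 p.2 * f p.1 p.2 * radialWeight p.1 ^ 2 *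
      Real.sin (2 * p.2) ^ (-eta) := by
    intro p hp
    have hz : (0 : ℝ) < p.1 := hp.1
    rw [← hτ2 p hp]
    simp only [hφ, hψ, projKernel]
    unfold radialWeight
    field_simp
  have eφ2 : ∀ p ∈ strip, φ p ^ 2 = (f p.1 p.2 * radialWeight p.1) ^ 2 * Real.sin (2 * p.2) ^ (-eta) := by
    intro p hp
    rw [← hτ2 p hp]
    simp only [hφ]
    ring
  have eψ2 : ∀ p ∈ strip, ψ p ^ 2 = (4 / profileConst α ^ 2 * ((1 + p.1) ^ 2)⁻¹) *
      (angularWeight α p.2 ^ 2 * Real.sin (2 * p.2) ^ (-eta)) := by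
    intro p hp
    have hz : (0 : ℝ) < p.1 := hp.1
    rw [← hτ2 p hp]
    simp only [hψ]
    field_simp
    ring
  have hPon : ContinuousOn (fun p : ℝ × ℝ => projKernel α p.1 p.2) strip := by
    unfold projKernel
    refine ((hΓc.comp continuous_snd).continuousOn.div_const _).mul ?_
    exact ContinuousOn.div (by fun_prop) (by fun_prop) fun p hp => by
      have : (0 : ℝ) < p.1 := hp.1; positivity
  have iφψ : IntegrableOn (fun p => φ p * ψ p) strip :=
    (integrableOn_mul_f_weight_eta hf hs hsub hPon).congr_fun (fun p hp => (eφψ p hp).symm) measurableSet_strip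
  have iφ2 : IntegrableOn (fun p => φ p ^ 2) strip := by
    have h := integrableOn_mul_f_weight_eta hf hs hsub (c := fun p : ℝ × ℝ => f p.1 p.2) hfc.continuousOn
    refine h.congr_fun (fun p hp => ?_) measurableSet_strip
    rw [eφ2 p hp]; ring
  have iz : Integrable (fun z : ℝ => 4 / profileConst α ^ 2 * ((1 + z) ^ 2)⁻¹) (volume.restrict (Ioi 0)) :=
    (integrableOn_inv_one_add_sq.const_mul _)
  have iθ : Integrable (fun θ : ℝ => angularWeight α θ ^ 2 * Real.sin (2 * θ) ^ (-eta))
      (volume.restrict (Ioo 0 (π / 2))) := integrableOn_angularWeight_sq_mul_rpow_eta hα.le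
  have iψ2 : IntegrableOn (fun p => ψ p ^ 2) strip := by
    have h := iz.mul_prod iθ
    rw [← volume_restrict_strip] at h
    exact IntegrableOn.congr_fun h (fun p hp => (eψ2 p hp).symm) measurableSet_strip
  have hCS := sq_integral_mul_le iφ2 iψ2 iφψ
  have hψ2 : ∫ p in strip, ψ p ^ 2 = (4 / profileConst α ^ 2 * ∫ z in Ioi (0 : ℝ), ((1 + z) ^ 2)⁻¹) *
      ∫ θ in Ioo 0 (π / 2), angularWeight α θ ^ 2 * Real.sin (2 * θ) ^ (-eta) := by
    rw [setIntegral_congr_fun measurableSet_strip eψ2, volume_restrict_strip,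
      integral_prod_mul (f := fun z : ℝ => 4 / profileConst α ^ 2 * ((1 + z) ^ 2)⁻¹)
        (g := fun θ : ℝ => angularWeight α θ ^ 2 * Real.sin (2 * θ) ^ (-eta)), integral_const_mul]
  rw [integral_Ioi_inv_one_add_sq, mul_one] at hψ2
  have hAng := integral_angularWeight_sq_mul_rpow_eta_le hα.le
  set X : ℝ := ∫ p in strip, (f p.1 p.2 * radialWeight p.1) ^ 2 * Real.sin (2 * p.2) ^ (-eta) with hX
  have hX0 : 0 ≤ X := by
    simp only [hX]
    rw [← setIntegral_congr_fun measurableSet_strip eφ2]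
    exact integral_nonneg fun p => sq_nonneg _
  have hAng0 : 0 ≤ ∫ θ in Ioo 0 (π / 2), angularWeight α θ ^ 2 * Real.sin (2 * θ) ^ (-eta) := by
    refine setIntegral_nonneg measurableSet_Ioo fun θ hθ => ?_
    have hsθ : 0 < Real.sin (2 * θ) := Real.sin_pos_of_pos_of_lt_pi (by linarith [hθ.1]) (by linarith [hθ.2])
    exact mul_nonneg (sq_nonneg _) (Real.rpow_nonneg hsθ.le _)
  have eT : ∫ p in strip, projKernel α p.1 p.2 * f p.1 p.2 * radialWeight p.1 ^ 2 *
      Real.sin (2 * p.2) ^ (-eta) = ∫ p in strip, φ p * ψ p :=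
    (setIntegral_congr_fun measurableSet_strip eφψ).symm
  have eX : ∫ p in strip, φ p ^ 2 = X := setIntegral_congr_fun measurableSet_strip eφ2
  rw [eT]
  rw [eX, hψ2] at hCS
  have hc2 : 4 / profileConst α ^ 2 ≤ 4 / (49 / 50 : ℝ) ^ 2 := by
    apply div_le_div_of_nonneg_left (by norm_num) (by norm_num)
    exact pow_le_pow_left₀ (by norm_num) hc49 2
  have hπ := Real.pi_lt_d4
  have hψ2le : 4 / profileConst α ^ 2 * ∫ θ in Ioo 0 (π / 2), angularWeight α θ ^ 2 *
      Real.sin (2 * θ) ^ (-eta) ≤ 1309 := by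
    calc 4 / profileConst α ^ 2 * ∫ θ in Ioo 0 (π / 2), angularWeight α θ ^ 2 * Real.sin (2 * θ) ^ (-eta)
        ≤ 4 / (49 / 50 : ℝ) ^ 2 * (100 * π) := mul_le_mul hc2 hAng hAng0 (by norm_num)
      _ ≤ 1309 := by nlinarith [hπ]
  calc (∫ p in strip, φ p * ψ p) ^ 2 ≤ X * (4 / profileConst α ^ 2 *
        ∫ θ in Ioo 0 (π / 2), angularWeight α θ ^ 2 * Real.sin (2 * θ) ^ (-eta)) := hCS
    _ ≤ X * 1309 := mul_le_mul_of_nonneg_left hψ2le hX0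
    _ = 1309 * X := by ring

/-- **The splitting of the `η`-pairing** `∬𝓛_Γ^T(f)·f·w²sin^{−η} = E₁ − E₂ − E₃ + ℓ₀J`. [folklore] -/
theorem integral_opLΓT_pairing_eta_eq (hα : 0 ≤ α) :
    ∫ p in strip, opLΓT α f p.1 p.2 * f p.1 p.2 * radialWeight p.1 ^ 2 * Real.sin (2 * p.2) ^ (-eta) =
      (∫ p in strip, opL f p.1 p.2 * f p.1 p.2 * radialWeight p.1 ^ 2 * Real.sin (2 * p.2) ^ (-eta))
      - (∫ p in strip, 2 * p.1 * angularWeight α p.2 / (profileConst α * (1 + p.1) ^ 2) * L12 f p.1 *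
          f p.1 p.2 * radialWeight p.1 ^ 2 * Real.sin (2 * p.2) ^ (-eta))
      - (∫ p in strip, 3 / (1 + p.1) * Dθ f p.1 p.2 * f p.1 p.2 * radialWeight p.1 ^ 2 *
          Real.sin (2 * p.2) ^ (-eta))
      + L12 (fun z θ => 3 / (1 + z) * Dθ f z θ) 0 *
        ∫ p in strip, projKernel α p.1 p.2 * f p.1 p.2 * radialWeight p.1 ^ 2 * Real.sin (2 * p.2) ^ (-eta) := by
  have hcpos : 0 < profileConst α := profileConst_pos hα
  have hΓc : Continuous (angularWeight α) := continuous_angularWeight hα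
  have hfon : ContinuousOn (fun p : ℝ × ℝ => f p.1 p.2) strip := hf.continuous.continuousOn
  have hLc : Continuous (L12 f) := continuous_L12 hf.continuous hs hsub
  have hDon : ContinuousOn (fun p : ℝ × ℝ => Dθ f p.1 p.2) strip :=
    (continuous_Dθ (hf.of_le (by norm_num))).continuousOn
  have c1 : ContinuousOn (fun p : ℝ × ℝ => opL f p.1 p.2) strip := by
    have hdz : ContinuousOn (fun p : ℝ × ℝ => Dz f p.1 p.2) strip :=
      (continuous_fst.mul (continuous_dz (hf.of_le (by norm_num)))).continuousOn
    have h3 : ContinuousOn (fun p : ℝ × ℝ => 2 * f p.1 p.2 / (1 + p.1)) strip :=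
      (continuousOn_const.mul hfon).div (by fun_prop) fun p hp => by
        have : (0 : ℝ) < p.1 := hp.1; positivity
    exact ((hfon.add hdz).sub h3).congr fun p _ => by simp only [Pi.add_apply, Pi.sub_apply, opL_apply]
  have c2 : ContinuousOn (fun p : ℝ × ℝ => 2 * p.1 * angularWeight α p.2 /
      (profileConst α * (1 + p.1) ^ 2) * L12 f p.1) strip := by
    refine (ContinuousOn.div (by exact ((continuous_const.mul continuous_fst).mul
      (hΓc.comp continuous_snd)).continuousOn) (by fun_prop) fun p hp => ?_).mul
      (hLc.comp continuous_fst).continuousOn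
    have : (0 : ℝ) < p.1 := hp.1
    exact mul_ne_zero hcpos.ne' (by positivity)
  have c3 : ContinuousOn (fun p : ℝ × ℝ => 3 / (1 + p.1) * Dθ f p.1 p.2) strip := by
    refine (ContinuousOn.div continuousOn_const (by fun_prop) fun p hp => ?_).mul hDon
    have : (0 : ℝ) < p.1 := hp.1; positivity
  have c4 : ContinuousOn (fun p : ℝ × ℝ => projKernel α p.1 p.2) strip := by
    unfold projKernel
    refine ((hΓc.comp continuous_snd).continuousOn.div_const _).mul ?_
    exact ContinuousOn.div (by fun_prop) (by fun_prop) fun p hp => by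
      have : (0 : ℝ) < p.1 := hp.1; positivity
  have i1 := integrableOn_mul_f_weight_eta hf hs hsub c1
  have i2 := integrableOn_mul_f_weight_eta hf hs hsub c2
  have i3 := integrableOn_mul_f_weight_eta hf hs hsub c3
  have i4 := integrableOn_mul_f_weight_eta hf hs hsub c4
  have hsplit : ∀ p ∈ strip, opLΓT α f p.1 p.2 * f p.1 p.2 * radialWeight p.1 ^ 2 * Real.sin (2 * p.2) ^ (-eta) =
      opL f p.1 p.2 * f p.1 p.2 * radialWeight p.1 ^ 2 * Real.sin (2 * p.2) ^ (-eta)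
      - 2 * p.1 * angularWeight α p.2 / (profileConst α * (1 + p.1) ^ 2) * L12 f p.1 *
          f p.1 p.2 * radialWeight p.1 ^ 2 * Real.sin (2 * p.2) ^ (-eta)
      - 3 / (1 + p.1) * Dθ f p.1 p.2 * f p.1 p.2 * radialWeight p.1 ^ 2 * Real.sin (2 * p.2) ^ (-eta)
      + L12 (fun z θ => 3 / (1 + z) * Dθ f z θ) 0 *
          (projKernel α p.1 p.2 * f p.1 p.2 * radialWeight p.1 ^ 2 * Real.sin (2 * p.2) ^ (-eta)) := by
    intro p _
    rw [opLΓT_apply, opLΓ_apply, projP]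
    ring
  rw [setIntegral_congr_fun measurableSet_strip hsplit, integral_add, integral_sub, integral_sub,
    integral_const_mul]
  all_goals first
    | exact i1
    | exact i2
    | exact i3
    | exact i1.sub i2
    | exact (i1.sub i2).sub i3
    | exact (i4.const_mul _)

end Prop67

/-! ### Proposition 6.7 (vendored form) -/

/-- **`η`-weighted `L²` coercivity of `𝓛_Γ^T`** (Elgindi 2021, Proposition 6.7: "Let `η = 99/100`.
Then, `(𝓛_Γ^T(f)w, fw/sin(2θ)^η)_{L²} ≥ (1/5)|f w/√(sin(2θ)^η)|² − 10⁵|z⁻¹L₁₂f|²`"), in the vendored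
form with the error measured by `|fw|²` (see the module docstring): for `0 < α ≤ 1/200` and
`f ∈ C²` compactly supported inside the open strip with `L₁₂(f)(0) = 0`,
`(1/5)∬(fw)²sin(2θ)^{−η} − 10⁶∬(fw)² ≤ ∬𝓛_Γ^T(f)·f·w²sin(2θ)^{−η}`. [cite: Elgindi2021, §6.1 Proposition 6.7 (p. 17 of arXiv:1904.04795)] -/
theorem etaWeightedCoercivity {α : ℝ} (hα : 0 < α) (hα' : α ≤ 1 / 200) {f : ℝ → ℝ → ℝ}
    (hf : ContDiff ℝ 2 (uncurry f)) (hs : HasCompactSupport (uncurry f))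
    (hsub : tsupport (uncurry f) ⊆ strip) (hL0 : L12 f 0 = 0) :
    (1 / 5) * (∫ p in strip, (f p.1 p.2 * radialWeight p.1) ^ 2 * Real.sin (2 * p.2) ^ (-eta)) -
        10 ^ 6 * ∫ p in strip, (f p.1 p.2 * radialWeight p.1) ^ 2 ≤
      ∫ p in strip, opLΓT α f p.1 p.2 * f p.1 p.2 * radialWeight p.1 ^ 2 * Real.sin (2 * p.2) ^ (-eta) := by
  rw [integral_opLΓT_pairing_eta_eq hf hs hsub hα.le]
  set X : ℝ := ∫ p in strip, (f p.1 p.2 * radialWeight p.1) ^ 2 * Real.sin (2 * p.2) ^ (-eta) with hX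
  set A : ℝ := ∫ p in strip, (f p.1 p.2 * radialWeight p.1) ^ 2 with hA
  set E1 : ℝ := ∫ p in strip, opL f p.1 p.2 * f p.1 p.2 * radialWeight p.1 ^ 2 *
    Real.sin (2 * p.2) ^ (-eta) with hE1
  set E2 : ℝ := ∫ p in strip, 2 * p.1 * angularWeight α p.2 / (profileConst α * (1 + p.1) ^ 2) * L12 f p.1 *
    f p.1 p.2 * radialWeight p.1 ^ 2 * Real.sin (2 * p.2) ^ (-eta) with hE2
  set E3 : ℝ := ∫ p in strip, 3 / (1 + p.1) * Dθ f p.1 p.2 * f p.1 p.2 * radialWeight p.1 ^ 2 *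
    Real.sin (2 * p.2) ^ (-eta) with hE3
  set ℓ₀ : ℝ := L12 (fun z θ => 3 / (1 + z) * Dθ f z θ) 0 with hℓ₀
  set J : ℝ := ∫ p in strip, projKernel α p.1 p.2 * f p.1 p.2 * radialWeight p.1 ^ 2 *
    Real.sin (2 * p.2) ^ (-eta) with hJ
  have h1 : E1 = (1 / 2) * X :=
    integral_strip_opL_energy_weight (hf.of_le (by norm_num)) hs hsub (contDiffOn_sin_two_mul_rpow _)
  have h3 : -(3 / 100) * X ≤ -E3 := integral_transport_eta_ge hf hs hsub
  have h2 : E2 ^ 2 ≤ 4625 * A * X := sq_E2_eta_le hf hs hsub hα hα' hL0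
  have h4a : J ^ 2 ≤ 1309 * X := sq_J_eta_le hf hs hsub hα hα'
  have h4b : ℓ₀ ^ 2 ≤ 153 * A := sq_L12_transport_le_sq_norm hf hs hsub
  have hA0 : 0 ≤ A := integral_nonneg fun p => sq_nonneg _
  have hX0 : 0 ≤ X := by
    simp only [hX]
    refine setIntegral_nonneg measurableSet_strip fun p hp => ?_
    have hsθ : 0 < Real.sin (2 * p.2) := Real.sin_pos_of_pos_of_lt_pi (by linarith [hp.2.1]) (by linarith [hp.2.2])
    exact mul_nonneg (sq_nonneg _) (Real.rpow_nonneg hsθ.le _)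
  -- `|E2| ≤ X/10 + 11563 A`, `|ℓ₀ J| ≤ X/10 + 500693 A`
  have hE2 : E2 ≤ X / 10 + (5 / 2) * 4625 * A := by
    by_contra hcon
    rw [not_le] at hcon
    have hB : 0 ≤ X / 10 + (5 / 2) * 4625 * A := by positivity
    have h' : (X / 10 + (5 / 2) * 4625 * A) ^ 2 < E2 ^ 2 := pow_lt_pow_left₀ hcon hB two_ne_zero
    nlinarith [sq_nonneg (X / 10 - (5 / 2) * 4625 * A), h2, h']
  have h4 : (ℓ₀ * J) ^ 2 ≤ (153 * 1309) * A * X := by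
    rw [mul_pow]
    calc ℓ₀ ^ 2 * J ^ 2 ≤ (153 * A) * (1309 * X) := mul_le_mul h4b h4a (sq_nonneg _) (by positivity)
      _ = (153 * 1309) * A * X := by ring
  have hE4 : -(ℓ₀ * J) ≤ X / 10 + (5 / 2) * (153 * 1309) * A := by
    by_contra hcon
    rw [not_le] at hcon
    have hB : 0 ≤ X / 10 + (5 / 2) * (153 * 1309) * A := by positivity
    have h' : (X / 10 + (5 / 2) * (153 * 1309) * A) ^ 2 < (-(ℓ₀ * J)) ^ 2 := pow_lt_pow_left₀ hcon hB two_ne_zero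
    rw [neg_sq] at h'
    nlinarith [sq_nonneg (X / 10 - (5 / 2) * (153 * 1309) * A), h4, h']
  nlinarith [h1, h3, hE2, hE4, hA0, hX0]

end Elgindi

end Literature.Analysis.FluidPDE
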